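import Summits.AtomisticToContinuum.Crystallization.Theorems.ChargedEnergyGapBlockSets
import Summits.AtomisticToContinuum.Crystallization.Theorems.ChargedEnergyGapTubeCharging
import HarnessLib

/-!
# Charged energy gap — lens-3 g65, node «BarlowRef» (R3) — part 28d «BlockExhibition»: ITEM 4, the tube block exhibition of record

Line `stmt-AtomisticToContinuum-14231`.  ★★★ `tubeBlockExhibition_record`: the canonical blocks of part 28c realise
`TubeBlockExhibition (3/5) (1/3) 3 (1/100) 160 80 (101/5) 18 (1/2100) (1/46) (5·10⁷·226981) {U, H}` with the two-band table
`U = (ϱc, ℓ, b, θ) = (0, 0, 60, 1/2100)` (off `X`) and `H = (0, 0, 40, 5·10⁷)` (on `X`).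

THE ARGUMENT (per live pair `(y, z)`, `y` a bulk source, `z ≠ y` a far target; memo g65 §3):
* CASE H (`holeSet y z ≠ ∅`): the block is the set of excised sites within `81/100` of the segment having a paying site within `20`; each
  member is in the near zone (value `B_H/θ_H = 226981 ≥ N_q` for every `q`, part 28a) and keeps clearance `60 − 20 = 40` from far targets;
  the budget inequality holds with `q :=` any member.
* CASE B (`holeSet y z = ∅`): walk the segment.  The margins «level `≥ 140`, `d(·, Dᵢ) ≥ 60` (`σᵢ`), `≤ 60` (`¬σᵢ`)» hold strictly at `y`
  (level `≥ 160`, `dᵢ ≥ 80` / `≤ 40`).  FRONTIER LEMMA (part 28b `exists_good_at_end`, covering radius `81/100` of the Barlow image, step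
  `18/|y − z|`): as long as the margins hold on `[0, t₁]`, every covering site near the path is paying or excised, an excised one `20`-close to a
  paying one would be a hole candidate (excluded), so a paying site within `81/100` of `y + t₁•(z − y)` exists.  Hence (i) some parameter in
  `[0, 1]` is critical — else a paying site within `81/100 < 60` of `z` puts `z` in the near zone; (ii) at the first critical point `p⋆`
  (`first_critical_spec`) there is a paying site `q′` within `81/100`.  The block is `P.points ∩ B̄(p⋆, 18.81) ⊇ P.points ∩ B̄(q′, 18)`; by
  `member_of_critical` every member has level `≥ 121.19`, listed distances `≥ 41.19` / `≤ 78.81`, and level `≤ 158.81` or a listed distance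
  in `(40, 80)`: a non-excised member is paying with value `≥ 1` per unit `θ_U` (part 28a `one_le_chargeBudget_div_record`) and clearance
  `60`; an excised member is within `19.62` of `q′`, so in the near zone (value `≥ N`) with clearance `≥ 40.38 ≥ 40`.  The budget inequality
  holds with `q := q′`: `N_{q′} = Σ_{B̄(q′,18)} 1 ≤ Σ_{block} value`.
Equivariance and periodicity are part 28c (`blk_add`, `band_add`).  ELEMENTARY · PROVED, 0 sorry.
-/

noncomputable section

open scoped Classical

open Literature.MathematicalPhysics.StatisticalMechanics Literature.Geometry.DiscreteGeometry
open Summit.AtomisticToContinuum.Crystallization.Theses.PricedLinkCensus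
open Summit.AtomisticToContinuum.Crystallization.Theorems.ChargedEnergyGapNegative

namespace Summit.AtomisticToContinuum.Crystallization.Theorems.ChargedEnergyGapChartDial

section Exhibition

variable {P : PeriodicConfiguration 3} {X C : Set E3} {m : ℕ} {D : Fin m → Set E3} {σ : Fin m → Bool}

/-! ### Paying sites from margins -/

/-- A bulk source is a paying site … -/
theorem pay_of_isBulkSource {y : E3} (hy : y ∈ P.points) (hb : IsBulkSource 80 D σ X 160 C y) : Pay P X C D σ y := by
  refine ⟨hy, hb.1, ?_⟩
  rw [hb.2.1, mul_one]
  exact hb.2.2.2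

/-- … of level `≥ 160`. -/
theorem level_of_isBulkSource {y : E3} (hb : IsBulkSource 80 D σ X 160 C y) : 160 ≤ Metric.infDist y C :=
  le_infDist_of_profileWeight_eq_one (by norm_num) hb.2.1

/-- A non-excised site within `δ < 20` of a point with the margins (level `≥ 140`, listed distances `≥ 60` / `≤ 60`) is paying. -/
theorem pay_of_margins {p q : E3} {δ : ℝ} (hq : q ∈ P.points) (hqX : q ∉ X) (hd : dist q p ≤ δ) (hδ : δ < 20)
    (hL : 140 ≤ Metric.infDist p C) (hcl : ClearOf D σ 60 60 p) : Pay P X C D σ q := by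
  refine ⟨hq, hqX, (hcl.of_dist_le hd).paying (by norm_num) (by linarith) (by linarith) (by norm_num) ?_⟩
  have h2 : Metric.infDist p C ≤ Metric.infDist q C + dist p q := Metric.infDist_le_infDist_add_dist
  rw [dist_comm] at h2
  linarith

/-! ### The frontier of paying sites along the segment -/

/-- ★ If the hole candidates of `(y, z)` are void and the margins hold along `[0, t₁]`, a paying site lies within `81/100` of `y + t₁•(z − y)`. -/
theorem exists_pay_near_end (hBar : IsBarlowImage P.points) {y z : E3} (hy : y ∈ P.points) (hyb : IsBulkSource 80 D σ X 160 C y)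
    (hyz : y ≠ z) (hH : holeSet P X C D σ y z = ∅) {t₁ : ℝ} (ht₁ : t₁ ∈ Set.Icc (0 : ℝ) 1)
    (hmarg : ∀ t, 0 ≤ t → t ≤ t₁ → 140 ≤ Metric.infDist (y + t • (z - y)) C ∧
      (∀ i, σ i = true → 60 ≤ Metric.infDist (y + t • (z - y)) (D i)) ∧ (∀ i, σ i = false → Metric.infDist (y + t • (z - y)) (D i) ≤ 60)) :
    ∃ q, Pay P X C D σ q ∧ dist q (y + t₁ • (z - y)) ≤ 81 / 100 := by
  have hd0 : 0 < dist y z := dist_pos.2 hyz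
  refine exists_good_at_end (Good := Pay P X C D σ) (Bad := fun c => c ∈ P.points ∧ c ∈ X) (η := 18 / dist y z) (K := 20)
    (div_pos (by norm_num) hd0) ?_ ht₁ ?_ ⟨y, pay_of_isBulkSource hy hyb, by rw [dist_self]; norm_num⟩ ?_
  · rw [div_mul_cancel₀ _ hd0.ne']
    norm_num
  · intro t h0 h1
    obtain ⟨x, hx, hdx⟩ := hBar.exists_dist_le (y + t • (z - y))
    rw [dist_comm] at hdx
    by_cases hxX : x ∈ X
    · exact ⟨x, hdx, Or.inr ⟨hx, hxX⟩⟩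
    · obtain ⟨hL, ha, hb⟩ := hmarg t h0 h1
      exact ⟨x, hdx, Or.inl (pay_of_margins hx hxX hdx (by norm_num) hL fun i => ⟨ha i, hb i⟩)⟩
  · rintro q c hq ⟨hc, hcX⟩ ⟨t, h0, h1, hdt⟩ hqc
    have : c ∈ holeSet P X C D σ y z := ⟨hc, hcX, ⟨t, h0, h1.trans ht₁.2, hdt⟩, q, hq, hqc⟩
    rw [hH] at this
    exact this

/-- ★★ CASE B: if the hole candidates are void then `t⋆ ∈ (0, 1]`, the margins hold along `[0, t⋆]`, one of them is tight at `p⋆`, and a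
paying site `q′` lies within `81/100` of `p⋆`. -/
theorem caseB_spec (hBar : IsBarlowImage P.points) {y z : E3} (hy : y ∈ P.points) (hyb : IsBulkSource 80 D σ X 160 C y)
    (hz : IsFarTarget 80 D σ P X 160 C z) (hyz : y ≠ z) (hH : holeSet P X C D σ y z = ∅) :
    (0 < tStar C D σ y z ∧ tStar C D σ y z ≤ 1) ∧
    (∀ t, 0 ≤ t → t ≤ tStar C D σ y z → 140 ≤ Metric.infDist (y + t • (z - y)) C ∧
      (∀ i, σ i = true → 60 ≤ Metric.infDist (y + t • (z - y)) (D i)) ∧ (∀ i, σ i = false → Metric.infDist (y + t • (z - y)) (D i) ≤ 60)) ∧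
    (Metric.infDist (pStar C D σ y z) C ≤ 140 ∨ ∃ i, (σ i = true ∧ Metric.infDist (pStar C D σ y z) (D i) ≤ 60) ∨
      (σ i = false ∧ 60 ≤ Metric.infDist (pStar C D σ y z) (D i))) ∧
    ∃ q', Pay P X C D σ q' ∧ dist q' (pStar C D σ y z) ≤ 81 / 100 := by
  have hyL : 140 < Metric.infDist y C := by linarith [level_of_isBulkSource hyb]
  have hcl := ClearOf.of_isBulkSource (D := D) (σ := σ) (by norm_num : (0 : ℝ) < 80) hyb
  have hya : ∀ i, σ i = true → 60 < Metric.infDist y (D i) := fun i hi => by linarith [(hcl i).1 hi]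
  have hyb' : ∀ i, σ i = false → Metric.infDist y (D i) < 60 := fun i hi => by linarith [(hcl i).2 hi]
  -- (i) some parameter of `[0, 1]` is critical
  have hcrit : ∃ t₁ ∈ Set.Icc (0 : ℝ) 1, t₁ ∈ criticalSet C D σ 140 60 60 y z := by
    by_contra hne
    push Not at hne
    have hmarg : ∀ t : ℝ, 0 ≤ t → t ≤ 1 → 140 ≤ Metric.infDist (y + t • (z - y)) C ∧
        (∀ i, σ i = true → 60 ≤ Metric.infDist (y + t • (z - y)) (D i)) ∧
        (∀ i, σ i = false → Metric.infDist (y + t • (z - y)) (D i) ≤ 60) := by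
      intro t h0 h1
      have ht := hne t ⟨h0, h1⟩
      simp only [criticalSet, Set.mem_setOf_eq, not_or, not_exists, not_and, not_le] at ht
      exact ⟨ht.1.le, fun i hi => (ht.2 i).1 hi |>.le, fun i hi => (ht.2 i).2 hi |>.le⟩
    obtain ⟨q, hq, hqz⟩ := exists_pay_near_end hBar hy hyb hyz hH ⟨zero_le_one, le_rfl⟩ hmarg
    rw [one_smul, add_sub_cancel] at hqz
    refine hz.2 (mem_nearZone_of_paying hq.1 hq.2.1 hq.2.2 ?_)
    rw [dist_comm]
    linarith
  obtain ⟨t₁, ht₁, ht₁S⟩ := hcrit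
  obtain ⟨h0, h1, hmem, hmarg⟩ := first_critical_spec hyL hya hyb' ht₁ ht₁S
  refine ⟨⟨h0, h1⟩, hmarg, ?_, ?_⟩
  · exact mem_criticalSet_iff.1 hmem
  · exact exists_pay_near_end hBar hy hyb hyz hH ⟨h0.le, h1⟩ hmarg

/-! ### The exhibition -/

/-- The clearance table: `40` on the hole band, `60` on the uncored band. -/
def bandClearance (i : Bool) : ℝ := if i = true then 40 else 60

/-- The rate table: `5·10⁷` on the hole band, `1/2100` on the uncored band. -/
def bandRate (i : Bool) : ℝ := if i = true then 50000000 else 1 / 2100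

/-- [formal bookkeeping] -/
theorem bandRate_of_mem {c : E3} (hc : c ∈ X) : bandRate (band X c) = 50000000 := by simp [bandRate, band, hc]

/-- [formal bookkeeping] -/
theorem bandRate_of_not_mem {c : E3} (hc : c ∉ X) : bandRate (band X c) = 1 / 2100 := by simp [bandRate, band, hc]

/-- [formal bookkeeping] -/
theorem bandClearance_of_mem {c : E3} (hc : c ∈ X) : bandClearance (band X c) = 40 := by simp [bandClearance, band, hc]

/-- [formal bookkeeping] -/
theorem bandClearance_of_not_mem {c : E3} (hc : c ∉ X) : bandClearance (band X c) = 60 := by simp [bandClearance, band, hc]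

/-- The charge budget per unit rate is non-negative. [formal bookkeeping] -/
theorem chargeBudget_div_bandRate_nonneg (c : E3) :
    0 ≤ chargeBudget 80 D σ P X 160 C (1 / 2100) (1 / 46) (50000000 * 226981) c / bandRate (band X c) := by
  refine div_nonneg (chargeBudget_nonneg 80 D σ P X 160 C (by norm_num) (by norm_num) (by norm_num) c) ?_
  unfold bandRate
  split_ifs <;> norm_num

/-- ★★★ **ITEM 4 — THE TUBE BLOCK EXHIBITION OF RECORD** at the two-band table `{U, H} = {(0, 0, 60, 1/2100), (0, 0, 40, 5·10⁷)}`,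
`B_H = 5·10⁷·226981`, tube radius `101/5`, block radius `18`. -/
theorem tubeBlockExhibition_record :
    TubeBlockExhibition (3 / 5) (1 / 3) 3 (1 / 100) 160 80 (101 / 5) 18 (1 / 2100) (1 / 46) (50000000 * 226981)
      (Finset.univ : Finset Bool) (fun _ => (0 : ℝ)) (fun _ => (0 : ℝ)) bandClearance bandRate := by
  intro P C X m D σ hsep hlab hBar hff hss hst hC hX hD
  refine ⟨blk P X C D σ hsep, band X, fun g hg y _ z _ _ _ _ => blk_add hX hC hD σ hg hsep y z, fun g hg c _ => band_add hX hg c, ?_⟩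
  intro y hy z hz hyb hzf hne
  refine ⟨fun c hc => blkSet_subset_points y z (mem_blk.1 hc), ?_⟩
  by_cases hH : (holeSet P X C D σ y z).Nonempty
  · -- CASE H: the hole candidates
    have hblk : ∀ c, c ∈ blk P X C D σ hsep y z ↔ c ∈ holeSet P X C D σ y z := fun c => by
      rw [mem_blk, blkSet, if_pos hH]
    refine ⟨fun c hc => ?_, ?_⟩
    · obtain ⟨hcP, hcX, ⟨t, h0, h1, hdt⟩, q, hq, hqc⟩ := (hblk c).1 hc
      refine ⟨Finset.mem_univ _, ?_, ⟨c, by rw [dist_self], fun y' _ _ => dist_nonneg⟩, fun z' _ hz' => ?_⟩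
      · calc Metric.infDist c (segment ℝ y z) ≤ dist c (y + t • (z - y)) := Metric.infDist_le_dist_of_mem (linePath_mem_segment h0 h1)
          _ ≤ 101 / 5 := by linarith
      · rw [bandClearance_of_mem hcX]
        have := hz'.le_dist_of_paying hq.1 hq.2.1 hq.2.2 hqc
        linarith
    · obtain ⟨c₀, hc₀⟩ := hH
      obtain ⟨hc₀P, hc₀X, ht, q, hq, hqc⟩ := hc₀
      have hnear : c₀ ∈ nearZone 80 D σ P X 160 C := mem_nearZone_of_paying hq.1 hq.2.1 hq.2.2 (by rw [dist_comm]; linarith)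
      refine ⟨c₀, hc₀P, (ncard_le_chargeBudget_div_record hsep hc₀X hnear c₀).trans ?_⟩
      have h5 := bandRate_of_mem hc₀X
      calc chargeBudget 80 D σ P X 160 C (1 / 2100) (1 / 46) (50000000 * 226981) c₀ / 50000000
          = chargeBudget 80 D σ P X 160 C (1 / 2100) (1 / 46) (50000000 * 226981) c₀ / bandRate (band X c₀) := by rw [h5]
        _ ≤ _ := Finset.single_le_sum (f := fun c => chargeBudget 80 D σ P X 160 C (1 / 2100) (1 / 46) (50000000 * 226981) c /
            bandRate (band X c)) (fun c _ => chargeBudget_div_bandRate_nonneg c) ((hblk c₀).2 ⟨hc₀P, hc₀X, ht, q, hq, hqc⟩)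
  · -- CASE B: the ball about the first critical point
    have hH' : holeSet P X C D σ y z = ∅ := Set.not_nonempty_iff_eq_empty.1 hH
    have hblk : ∀ c, c ∈ blk P X C D σ hsep y z ↔ c ∈ P.points ∧ dist c (pStar C D σ y z) ≤ 1881 / 100 := fun c => by
      rw [mem_blk, blkSet, if_neg hH]
      rfl
    obtain ⟨⟨h0, h1⟩, hmarg, htight, q', hq', hq'd⟩ := caseB_spec hBar hy hyb hzf (Ne.symm hne) hH'
    obtain ⟨hLp, hap, hbp⟩ := hmarg _ h0.le le_rfl
    have hclp : ClearOf D σ 60 60 (pStar C D σ y z) := fun i => ⟨hap i, hbp i⟩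
    -- the member analysis
    have hmem : ∀ c, c ∈ P.points → dist c (pStar C D σ y z) ≤ 1881 / 100 →
        (c ∉ X → Pay P X C D σ c ∧ 1 ≤ chargeBudget 80 D σ P X 160 C (1 / 2100) (1 / 46) (50000000 * 226981) c / bandRate (band X c)) ∧
        (c ∈ X → c ∈ nearZone 80 D σ P X 160 C ∧ dist q' c ≤ 1962 / 100) := by
      intro c hcP hcd
      obtain ⟨hLc, hac, hbc, horc⟩ := member_of_critical (σ := σ) hcd hLp hap hbp htight
      have hq'c : dist q' c ≤ 1962 / 100 := by
        have := dist_triangle q' (pStar C D σ y z) c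
        rw [dist_comm (pStar C D σ y z) c] at this
        linarith
      refine ⟨fun hcX => ?_, fun hcX => ⟨mem_nearZone_of_paying hq'.1 hq'.2.1 hq'.2.2 (by rw [dist_comm]; linarith), hq'c⟩⟩
      have hcl : ClearOf D σ (60 - 1881 / 100) (60 + 1881 / 100) c := hclp.of_dist_le hcd
      refine ⟨pay_of_margins hcP hcX hcd (by norm_num) hLp hclp, ?_⟩
      rw [bandRate_of_not_mem hcX]
      refine one_le_chargeBudget_div_record (by norm_num) (by norm_num) (by norm_num) hcX hcl (by linarith) ?_
      rcases horc with h | ⟨i, ⟨hi1, hi2⟩ | ⟨hi1, hi2⟩⟩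
      · left; linarith
      · exact Or.inr (one_le_transMult_of_inTransition (inTransition_of_dist (i := i) (by norm_num) (by linarith) (by linarith)))
      · exact Or.inr (one_le_transMult_of_inTransition (inTransition_of_dist (i := i) (by norm_num) (by linarith) (by linarith)))
    refine ⟨fun c hc => ?_, ?_⟩
    · obtain ⟨hcP, hcd⟩ := (hblk c).1 hc
      refine ⟨Finset.mem_univ _, ?_, ⟨c, by rw [dist_self], fun y' _ _ => dist_nonneg⟩, fun z' _ hz' => ?_⟩
      · calc Metric.infDist c (segment ℝ y z) ≤ dist c (pStar C D σ y z) := Metric.infDist_le_dist_of_mem (pStar_mem_segment y z)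
          _ ≤ 101 / 5 := by linarith
      · by_cases hcX : c ∈ X
        · rw [bandClearance_of_mem hcX]
          have := hz'.le_dist_of_paying hq'.1 hq'.2.1 hq'.2.2 ((hmem c hcP hcd).2 hcX).2
          linarith
        · rw [bandClearance_of_not_mem hcX]
          obtain ⟨hpay, -⟩ := (hmem c hcP hcd).1 hcX
          have := hz'.le_dist_of_paying_self hcP hcX hpay.2.2
          linarith
    · -- the budget inequality with `q := q'`
      have hfin := hsep.finite_inter_closedBall (by norm_num) q' 18
      refine ⟨q', hq'.1, ?_⟩
      have hsub : hfin.toFinset ⊆ blk P X C D σ hsep y z := by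
        intro c hc
        rw [Set.Finite.mem_toFinset] at hc
        refine (hblk c).2 ⟨hc.1, ?_⟩
        have := dist_triangle c q' (pStar C D σ y z)
        have := Metric.mem_closedBall.1 hc.2
        linarith
      calc ((P.points ∩ Metric.closedBall q' 18).ncard : ℝ) = ∑ _c ∈ hfin.toFinset, (1 : ℝ) := by
            rw [Finset.sum_const, nsmul_eq_mul, mul_one, Set.ncard_eq_toFinset_card _ hfin]
        _ ≤ ∑ c ∈ hfin.toFinset, chargeBudget 80 D σ P X 160 C (1 / 2100) (1 / 46) (50000000 * 226981) c / bandRate (band X c) := by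
            refine Finset.sum_le_sum fun c hc => ?_
            rw [Set.Finite.mem_toFinset] at hc
            have hcd : dist c (pStar C D σ y z) ≤ 1881 / 100 := by
              have := dist_triangle c q' (pStar C D σ y z)
              have := Metric.mem_closedBall.1 hc.2
              linarith
            by_cases hcX : c ∈ X
            · obtain ⟨hnear, -⟩ := (hmem c hc.1 hcd).2 hcX
              rw [bandRate_of_mem hcX]
              refine le_trans ?_ (ncard_le_chargeBudget_div_record hsep hcX hnear c)
              have hfc := hsep.finite_inter_closedBall (by norm_num) c 18
              exact_mod_cast (Set.ncard_pos hfc).2 ⟨c, hc.1, Metric.mem_closedBall_self (by norm_num)⟩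
            · exact ((hmem c hc.1 hcd).1 hcX).2
        _ ≤ _ := Finset.sum_le_sum_of_subset_of_nonneg hsub fun c _ _ => chargeBudget_div_bandRate_nonneg c

end Exhibition

end Summit.AtomisticToContinuum.Crystallization.Theorems.ChargedEnergyGapChartDial

end
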